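import Literature.Topology.FourManifolds.GluingProofs
import Literature.AlgebraicTopology.SingularHomology.FundamentalClassProofs
import Literature.AlgebraicTopology.SingularHomology.EulerCharacteristicTriple
import Literature.AlgebraicTopology.SingularHomology.BoundaryManifoldFiniteness
import HarnessLib

/-!
# The homology of a compact manifold with boundary vanishes above its dimension

For a compact smooth `(n+1)`-manifold with boundary `W` (charts into `EuclideanHalfSpace (n+1)`,
`C^∞` for `𝓡∂ (n+1)`), `Hₖ(W; M) = 0` for all `k > n + 1` and all coefficients — the relative
version with boundary of Hatcher 2002, §3.3, Thm. 3.26(c) / Lemma 3.27 ("`Hᵢ(M; R) = 0` for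
`i > n`").  Proof through the **double**: the tree glues two copies of `W` along the identity of
`∂W` into a closed smooth `(n+1)`-manifold `P = W ∪_{id} W` (`exists_isBoundaryGluing_holds`,
Bröcker–Jänich (13.11); Hirsch Ch. 8 §2), on which the fold map `r : P → W` (the inverse of
either embedding on its range — they agree on the seam) is a continuous retraction of the first
copy `jA : W ↪ P`; hence `jA_* : Hₖ(W) → Hₖ(P)` is injective, and `Hₖ(P) = 0` for `k > n + 1`
(closed manifolds: the tree's `isZero_singularHomology_of_lt_holds`).

* `BoundaryGluingData.exists_retraction_of_refl` — the fold retraction of a double;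
* `isZero_singularHomology_of_dim_lt` — `Hₖ(W; M) = 0` for `k > n + 1`;
* `finite_singularHomology_of_boundaryManifold`-free corollary for Euler characteristics:
  `finRelHomology_of_compactSpace_halfSpace` — `H_•(W; ℤ)` is finitely generated and zero from
  degree `n + 2` on (`FinRelHomology ℤ ℤ W ∅ (n + 2)`), the finiteness datum consumed by the
  Euler characteristic computations of `SmallExoticaFrontierReductionLemma8Proofs` (§6–§7) for the
  tube complements `Y ∖ ν°Σ` of Akhmedov–Park 2010.

Everything is proved; no definitions, no named facts.

## References

* A. Hatcher, *Algebraic Topology*, CUP 2002, §3.3 Thm. 3.26(c), Lemma 3.27. [HatcherAT2002]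
* T. Bröcker, K. Jänich, *Introduction to Differential Topology*, CUP 1982, (13.11) (the double).
  [BrockerJanich1982]
-/

noncomputable section

open scoped Manifold ContDiff Topology
open Set Function CategoryTheory Limits
open Literature.AlgebraicTopology.SingularHomology

universe u v

namespace Literature.Topology.FourManifolds

namespace BoundaryGluingData

variable {n : ℕ} {W : Type u} [TopologicalSpace W]
  [ChartedSpace (EuclideanHalfSpace (n + 1)) W] [CompactSpace W]
  {b : BoundaryData (𝓡∂ (n + 1)) W (𝓡 n)}
  {P : Type u} [TopologicalSpace P] [T2Space P] [ChartedSpace (EuclideanSpace ℝ (Fin (n + 1))) P]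

/-- **The fold retraction of a double.**  For gluing data of the double `P = W ∪_{id} W`
(`φ = Equiv.refl ∂W`) there is a continuous `r : P → W` with `r ∘ jA = id` (and `r ∘ jB = id`):
on `jA(W)` it is `jA⁻¹`, on `jB(W)` it is `jB⁻¹`, and these agree on the seam `jA a = jB b`,
where `a = b ∈ ∂W` (pasting along the closed cover). [cite: BrockerJanich1982, (13.11)] -/
theorem exists_retraction_of_refl [Nonempty W]
    (G : BoundaryGluingData b b (Equiv.refl b.carrier) P) :
    ∃ r : C(P, W), (∀ a, r (G.jA a) = a) ∧ ∀ a, r (G.jB a) = a := by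
  classical
  have hA : Topology.IsEmbedding G.jA := G.isSmoothEmbedding_jA.isEmbedding
  have hB : Topology.IsEmbedding G.jB := G.isSmoothEmbedding_jB.isEmbedding
  -- the fold map as a bare function
  let r : P → W := fun p => if p ∈ range G.jA then invFun G.jA p else invFun G.jB p
  have hrA : ∀ a, r (G.jA a) = a := fun a => by
    simp only [r, mem_range_self, if_true, leftInverse_invFun hA.injective a]
  have hseam : ∀ p ∈ range G.jA, p ∈ range G.jB → invFun G.jA p = invFun G.jB p := by
    rintro p ⟨a, rfl⟩ ⟨c, hc⟩
    obtain ⟨z, rfl, hz⟩ := (G.jA_eq_jB_iff a c).1 hc.symm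
    rw [leftInverse_invFun hA.injective, ← hc, leftInverse_invFun hB.injective, hz]
    rfl
  have hrB : ∀ a, r (G.jB a) = a := fun a => by
    by_cases h : G.jB a ∈ range G.jA
    · simp only [r, h, if_true]
      rw [hseam _ h (mem_range_self a), leftInverse_invFun hB.injective]
    · simp only [r, h, if_false, leftInverse_invFun hB.injective a]
  -- continuity by pasting along the closed cover `P = jA(W) ∪ jB(W)`
  have hcA : ContinuousOn r (range G.jA) := by
    have heq : EqOn r (invFun G.jA) (range G.jA) := fun p hp => by simp only [r, hp, if_true]
    refine ContinuousOn.congr ?_ heq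
    rw [continuousOn_iff_continuous_restrict]
    have : (range G.jA).restrict (invFun G.jA) = hA.toHomeomorph.symm := by
      ext ⟨p, a, rfl⟩
      simp only [restrict_apply, leftInverse_invFun hA.injective a]
      exact (hA.toHomeomorph_symm_apply a).symm
    rw [this]
    exact hA.toHomeomorph.symm.continuous
  have hcB : ContinuousOn r (range G.jB) := by
    have heq : EqOn r (invFun G.jB) (range G.jB) := fun p hp => by
      by_cases h : p ∈ range G.jA
      · simp only [r, h, if_true]; exact hseam p h hp
      · simp only [r, h, if_false]
    refine ContinuousOn.congr ?_ heq
    rw [continuousOn_iff_continuous_restrict]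
    have : (range G.jB).restrict (invFun G.jB) = hB.toHomeomorph.symm := by
      ext ⟨p, a, rfl⟩
      simp only [restrict_apply, leftInverse_invFun hB.injective a]
      exact (hB.toHomeomorph_symm_apply a).symm
    rw [this]
    exact hB.toHomeomorph.symm.continuous
  have hclA : IsClosed (range G.jA) := (isCompact_range hA.continuous).isClosed
  have hclB : IsClosed (range G.jB) := (isCompact_range hB.continuous).isClosed
  have hc : Continuous r := by
    rw [← continuousOn_univ, ← G.range_union]
    exact hcA.union_of_isClosed hcB hclA hclB
  exact ⟨⟨r, hc⟩, hrA, hrB⟩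

end BoundaryGluingData

/-- **The homology of a compact smooth manifold with boundary vanishes above its dimension**:
`Hₖ(W; M) = 0` for `k > n + 1`, `W` a compact smooth `(n+1)`-manifold with boundary
(Hatcher 2002, Thm. 3.26(c) for the closed double `W ∪_{id} W`, of which `W` is a retract).
[cite: HatcherAT2002, §3.3 Thm. 3.26(c)] -/
theorem isZero_singularHomology_of_dim_lt {n : ℕ} (W : Type u) [TopologicalSpace W] [T2Space W]
    [ChartedSpace (EuclideanHalfSpace (n + 1)) W] [IsManifold (𝓡∂ (n + 1)) ∞ W] [CompactSpace W]
    (R : Type v) [CommRing R] (M : Type v) [AddCommGroup M] [Module R M] {k : ℕ}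
    (hk : n + 1 < k) : IsZero (singularHomology R M W k) := by
  rcases isEmpty_or_nonempty W with hW | hW
  · exact isZero_singularHomology_of_subsingleton R M (X := W) (by omega)
  let b := BoundaryManifold.boundaryData n W
  obtain ⟨P, _, _, _, _, _, _, hP⟩ :=
    exists_isBoundaryGluing_holds b b (Diffeomorph.refl (𝓡 n) b.carrier ∞)
  obtain ⟨G⟩ := hP.nonempty_boundaryGluingData'
  obtain ⟨r, hrA, -⟩ := G.exists_retraction_of_refl
  have hP0 : IsZero (singularHomology R M P k) :=
    isZero_singularHomology_of_lt_holds (R := R) (M := M) (X := P) (n + 1) hk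
  have hcomp : r.comp ⟨G.jA, G.continuous_jA⟩ = ContinuousMap.id W := by
    ext a
    exact hrA a
  haveI : Mono (singularHomology.map R M (⟨G.jA, G.continuous_jA⟩ : C(W, P)) k) := by
    refine ⟨fun f g hfg => ?_⟩
    have := congrArg (· ≫ singularHomology.map R M r k) hfg
    simpa only [Category.assoc, ← singularHomology.map_comp, hcomp, singularHomology.map_id,
      Category.comp_id] using this
  exact hP0.of_mono (singularHomology.map R M (⟨G.jA, G.continuous_jA⟩ : C(W, P)) k)

/-- **The finiteness datum of a compact smooth manifold with boundary**: `H_•(W; ℤ)` is finitely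
generated (Hatcher App. A Cor. A.8–A.9, the tree's
`finite_singularHomology_of_compact_chartedSpace_halfSpace`) and zero from degree `n + 2` on —
`FinRelHomology ℤ ℤ W ∅ (n + 2)`, e.g. `FinRelHomology ℤ ℤ (Y ∖ ν°Σ) ∅ 5` for the tube
complements of Akhmedov–Park's surgeries and fibre sums.
[cite: HatcherAT2002, §3.3 Thm. 3.26(c) and App. A Cor. A.8–A.9] -/
theorem finRelHomology_of_compactSpace_halfSpace {n : ℕ} (W : Type u) [TopologicalSpace W]
    [T2Space W] [ChartedSpace (EuclideanHalfSpace (n + 1)) W] [IsManifold (𝓡∂ (n + 1)) ∞ W]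
    [CompactSpace W] : FinRelHomology ℤ ℤ W ∅ (n + 2) :=
  FinRelHomology.empty_of_absolute
    (fun k => finite_singularHomology_of_compact_chartedSpace_halfSpace ℤ ℤ (n := n) k)
    fun k hk => isZero_singularHomology_of_dim_lt (n := n) W ℤ ℤ (by omega)

end Literature.Topology.FourManifolds

end
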